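import Mathlib

/-!
# Route MoebiusRestrictionCurrents — helpers for the glue `CruxesGiveTarget`: inversions

Helper lemmas (supporting item `CruxesGiveTarget` of route `MoebiusRestrictionCurrents`,
sub-problem `Ising3DConformalLimit`; the glue itself is
`MoebiusRestrictionCurrentsCruxesGiveTarget.lean`), stated for a real inner product space `F`:

* admissibility (`IsOpen D ∧ μ (frontier D) = 0`) is preserved by an inversion on domains
  avoiding its center: the image is open (the inversion is a homeomorphism of the punctured
  space) and its frontier is contained in `{c} ∪ ι '' (frontier D ∖ {c})`, a null set for an
  additive Haar measure `μ` because the inversion is differentiable off the center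
  (Mathlib `MeasureTheory.addHaar_image_eq_zero_of_differentiableOn_of_addHaar_eq_zero`);
* a translation-, isometry- and dilation-covariant two-point kernel is the pure power
  `C‖x − y‖^{-2Δ}` (Householder reflection `Submodule.reflection_sub`), hence covariant under the
  unit inversion about the origin with weight `‖x‖^{2Δ}‖y‖^{2Δ}`
  (`EuclideanGeometry.dist_inversion_inversion`; Di Francesco–Mathieu–Sénéchal 1997, §4.1
  eq. (4.16) and §4.3.1).

Nothing here mentions the lattice model; the file imports Mathlib only.
-/

namespace Summit.CriticalPhenomena.Ising3DConformalLimit.Theorems.MoebiusRestrictionCurrents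

open scoped Topology
open Filter Set EuclideanGeometry MeasureTheory

section Inversion

variable {F : Type*} [NormedAddCommGroup F] [InnerProductSpace ℝ F]

/-- The inversion of nonzero radius is an involution, so images are preimages. [folklore] -/
theorem image_inversion_eq_preimage (c : F) {R : ℝ} (hR : R ≠ 0) (D : Set F) :
    inversion c R '' D = inversion c R ⁻¹' D :=
  congrFun (Set.image_eq_preimage_of_inverse (inversion_involutive c hR)
    (inversion_involutive c hR)) D

/-- The inversion is continuous away from its center. [folklore] -/
theorem continuousOn_inversion (c : F) (R : ℝ) : ContinuousOn (inversion c R) {c}ᶜ :=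
  continuousOn_const.inversion continuousOn_const continuousOn_id fun _ ha => ha

/-- The inversion is differentiable on every set avoiding its center. [folklore] -/
theorem differentiableOn_inversion (c : F) (R : ℝ) {s : Set F} (hs : c ∉ s) :
    DifferentiableOn ℝ (inversion c R) s :=
  (differentiableOn_const c).inversion (differentiableOn_const R) differentiableOn_id
    fun _ ha h => hs (h ▸ ha)

/-- The image of an open set avoiding the center under an inversion of nonzero radius is open
(cf. the same fact inside `Literature.Analysis.PDE.LoewnerNirenberg`, not imported here).
[folklore] -/
theorem isOpen_image_inversion (c : F) {R : ℝ} (hR : R ≠ 0) {D : Set F} (hD : IsOpen D)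
    (hc : c ∉ D) : IsOpen (inversion c R '' D) := by
  rw [image_inversion_eq_preimage c hR]
  have h : inversion c R ⁻¹' D = {c}ᶜ ∩ inversion c R ⁻¹' D := by
    ext z
    simp only [mem_preimage, mem_inter_iff, mem_compl_iff, mem_singleton_iff, iff_and_self]
    rintro hz rfl
    exact hc (by simpa [inversion_self] using hz)
  rw [h]
  exact (continuousOn_inversion c R).isOpen_inter_preimage isOpen_compl_singleton hD

/-- The frontier of the image of an open set `D ∌ c` under an inversion of center `c` and
nonzero radius lies in `{c} ∪ ι '' (frontier D ∖ {c})`. [folklore] -/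
theorem frontier_image_inversion_subset (c : F) {R : ℝ} (hR : R ≠ 0) {D : Set F}
    (hD : IsOpen D) (hc : c ∉ D) :
    frontier (inversion c R '' D) ⊆ {c} ∪ inversion c R '' (frontier D \ {c}) := by
  intro z hz
  by_cases hzc : z = c
  · exact Or.inl hzc
  right
  have hopen : IsOpen (inversion c R '' D) := isOpen_image_inversion c hR hD hc
  rw [hopen.frontier_eq, Set.mem_sdiff] at hz
  obtain ⟨hzcl, hzS⟩ := hz
  refine ⟨inversion c R z, ⟨?_, ?_⟩, inversion_inversion c hR z⟩
  · rw [hD.frontier_eq, Set.mem_sdiff]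
    constructor
    · have hcont : ContinuousAt (inversion c R) z :=
        (continuousOn_inversion c R).continuousAt (isOpen_compl_singleton.mem_nhds hzc)
      have h1 : inversion c R z ∈ closure (inversion c R '' (inversion c R '' D)) :=
        hcont.continuousWithinAt.mem_closure_image hzcl
      rwa [(inversion_involutive c hR).leftInverse.image_image] at h1
    · intro hzD
      exact hzS ⟨inversion c R z, hzD, inversion_inversion c hR z⟩
  · rw [mem_singleton_iff, inversion_eq_center hR]
    exact hzc

/-- Admissibility (`IsOpen D ∧ μ (frontier D) = 0`) of the full space. [folklore] -/
theorem adm_univ {α : Type*} [TopologicalSpace α] [MeasurableSpace α] (μ : Measure α) :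
    IsOpen (Set.univ : Set α) ∧ μ (frontier (Set.univ : Set α)) = 0 := by
  refine ⟨isOpen_univ, ?_⟩
  rw [frontier_univ, measure_empty]

/-- Admissibility (`IsOpen D ∧ μ (frontier D) = 0`, `μ` an additive Haar measure) is preserved by
an inversion of nonzero radius on domains avoiding its center: the image is open and its frontier,
contained in `{c} ∪ ι '' (frontier D ∖ {c})`, is `μ`-null because the inversion is differentiable
off the center. [folklore] -/
theorem adm_image_inversion [FiniteDimensional ℝ F] [MeasurableSpace F] [BorelSpace F]
    (μ : Measure F) [μ.IsAddHaarMeasure] [NullSingletonClass μ] (c : F) {R : ℝ} (hR : R ≠ 0) {D : Set F}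
    (hD : IsOpen D ∧ μ (frontier D) = 0) (hc : c ∉ D) :
    IsOpen (inversion c R '' D) ∧ μ (frontier (inversion c R '' D)) = 0 := by
  refine ⟨isOpen_image_inversion c hR hD.1 hc, ?_⟩
  refine measure_mono_null (frontier_image_inversion_subset c hR hD.1 hc) ?_
  refine measure_union_null (measure_singleton _) ?_
  refine addHaar_image_eq_zero_of_differentiableOn_of_addHaar_eq_zero μ
    (differentiableOn_inversion c R (fun h => h.2 rfl)) ?_
  exact measure_mono_null sdiff_subset hD.2

end Inversion

/-! ## Euclid- and scale-covariant two-point kernels -/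

section TwoPoint

variable {F : Type*} [NormedAddCommGroup F] [InnerProductSpace ℝ F]

/-- A two-point kernel which is translation invariant, invariant under linear isometries and
dilation covariant with exponent `-2Δ` off the diagonal is the pure power `‖y - x‖^{-2Δ} · K 0 e`
for any unit vector `e` (translate `x` to `0`, dilate `y - x` to the unit sphere, and move it to
`e` by the Householder reflection `Submodule.reflection_sub`). (Di Francesco–Mathieu–Sénéchal
1997, §4.3.1: two-point function of a quasi-primary field.) -/
theorem twoPoint_eq_rpow_of_covariant (K : F → F → ℝ) (Δ : ℝ)
    (hKt : ∀ v x y : F, x ≠ y → K (x + v) (y + v) = K x y)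
    (hKr : ∀ (R : F ≃ₗᵢ[ℝ] F) (x y : F), x ≠ y → K (R x) (R y) = K x y)
    (hKd : ∀ c : ℝ, 0 < c → ∀ x y : F, x ≠ y → K (c • x) (c • y) = c ^ (-(2 : ℝ) * Δ) * K x y)
    {e : F} (he : ‖e‖ = 1) {x y : F} (hxy : x ≠ y) :
    K x y = ‖y - x‖ ^ (-(2 : ℝ) * Δ) * K 0 e := by
  have hz0 : y - x ≠ 0 := sub_ne_zero.mpr hxy.symm
  have hr : 0 < ‖y - x‖ := norm_pos_iff.mpr hz0
  have hu1 : ‖‖y - x‖⁻¹ • (y - x)‖ = 1 := by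
    rw [norm_smul, norm_inv, norm_norm, inv_mul_cancel₀ hr.ne']
  have hu0 : (0 : F) ≠ ‖y - x‖⁻¹ • (y - x) := by
    intro h
    rw [← h, norm_zero] at hu1
    exact zero_ne_one hu1
  have hz0' : (0 : F) ≠ y - x := fun h => hz0 h.symm
  -- translation: `K x y = K 0 (y - x)`
  have h1 : K x y = K 0 (y - x) := by
    have h := hKt x 0 (y - x) hz0'
    rw [zero_add, sub_add_cancel] at h
    exact h
  -- dilation: `K 0 (y - x) = ‖y - x‖^{-2Δ} K 0 u`
  have h2 : K 0 (y - x) = ‖y - x‖ ^ (-(2 : ℝ) * Δ) * K 0 (‖y - x‖⁻¹ • (y - x)) := by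
    have h := hKd ‖y - x‖ hr 0 (‖y - x‖⁻¹ • (y - x)) hu0
    rw [smul_zero, smul_smul, mul_inv_cancel₀ hr.ne', one_smul] at h
    exact h
  -- Householder reflection: `K 0 u = K 0 e`
  have h3 : K 0 (‖y - x‖⁻¹ • (y - x)) = K 0 e := by
    have h := hKr (Submodule.reflection (ℝ ∙ (‖y - x‖⁻¹ • (y - x) - e))ᗮ) 0
      (‖y - x‖⁻¹ • (y - x)) hu0
    rw [map_zero, Submodule.reflection_sub (by rw [hu1, he])] at h
    exact h.symm
  rw [h1, h2, h3]

/-- Distances under the unit inversion about the origin: `‖ι y - ι x‖ = ‖y - x‖/(‖x‖‖y‖)`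
(Mathlib `EuclideanGeometry.dist_inversion_inversion`; Di Francesco–Mathieu–Sénéchal 1997,
§4.1 eq. (4.16)). -/
theorem norm_inversion_zero_one_sub {x y : F} (hx : x ≠ 0) (hy : y ≠ 0) :
    ‖inversion (0 : F) 1 y - inversion (0 : F) 1 x‖ = (‖x‖ * ‖y‖)⁻¹ * ‖y - x‖ := by
  rw [← dist_eq_norm, dist_inversion_inversion hy hx, dist_eq_norm, dist_eq_norm, dist_eq_norm,
    sub_zero, sub_zero]
  ring

/-- A translation-, isometry- and dilation-covariant (exponent `-2Δ`) two-point kernel is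
covariant under the unit inversion about the origin with weight `‖x‖^{2Δ}‖y‖^{2Δ}`:
`K (ι x) (ι y) = ‖x‖^{2Δ} ‖y‖^{2Δ} K x y` for `x, y ≠ 0`, `x ≠ y`.
(Di Francesco–Mathieu–Sénéchal 1997, §4.3.1 eq. (4.62) for `n = 2`.) -/
theorem twoPoint_inversion_of_covariant (K : F → F → ℝ) (Δ : ℝ)
    (hKt : ∀ v x y : F, x ≠ y → K (x + v) (y + v) = K x y)
    (hKr : ∀ (R : F ≃ₗᵢ[ℝ] F) (x y : F), x ≠ y → K (R x) (R y) = K x y)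
    (hKd : ∀ c : ℝ, 0 < c → ∀ x y : F, x ≠ y → K (c • x) (c • y) = c ^ (-(2 : ℝ) * Δ) * K x y)
    {x y : F} (hx : x ≠ 0) (hy : y ≠ 0) (hxy : x ≠ y) :
    K (inversion (0 : F) 1 x) (inversion (0 : F) 1 y) = ‖x‖ ^ (2 * Δ) * ‖y‖ ^ (2 * Δ) * K x y := by
  have hr : 0 < ‖y - x‖ := norm_pos_iff.mpr (sub_ne_zero.mpr hxy.symm)
  have he : ‖‖y - x‖⁻¹ • (y - x)‖ = 1 := by
    rw [norm_smul, norm_inv, norm_norm, inv_mul_cancel₀ hr.ne']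
  have hιxy : inversion (0 : F) 1 x ≠ inversion (0 : F) 1 y :=
    (inversion_injective 0 one_ne_zero).ne hxy
  rw [twoPoint_eq_rpow_of_covariant K Δ hKt hKr hKd he hιxy,
    twoPoint_eq_rpow_of_covariant K Δ hKt hKr hKd he hxy, norm_inversion_zero_one_sub hx hy,
    Real.mul_rpow (inv_nonneg.mpr (mul_nonneg (norm_nonneg _) (norm_nonneg _))) (norm_nonneg _),
    Real.inv_rpow (mul_nonneg (norm_nonneg _) (norm_nonneg _)),
    Real.mul_rpow (norm_nonneg _) (norm_nonneg _)]
  have h2Δ : (-(2 : ℝ) * Δ) = -(2 * Δ) := by ring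
  rw [h2Δ, Real.rpow_neg (norm_nonneg x), Real.rpow_neg (norm_nonneg y), mul_inv, inv_inv,
    inv_inv]
  ring

end TwoPoint

end Summit.CriticalPhenomena.Ising3DConformalLimit.Theorems.MoebiusRestrictionCurrents
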